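import Summits.Ventures.CertifiedManyBodySolver.Downfold.EmeryFermiOneBandRange
import Summits.Ventures.CertifiedManyBodySolver.Downfold.EmerySecularFormDefectAxial
import Summits.Ventures.CertifiedManyBodySolver.Downfold.EmeryFermiNodalVelocity
import Summits.Ventures.CertifiedManyBodySolver.Downfold.EmeryOrbitalWeightNode
import HarnessLib

/-!
# THE AXIAL CHANNEL AT THE FERMI VELOCITY, EXACTLY: the four-orbital energy denominator `W4 a′ = ∂_ε charCubic + a′·axialLin` obeys the
# t′-HARMONIC LAW `fsT·W4 a′ = (α + a′γ₀) + 8(β + a′γ₁)·s(k)` with `γ₁ = fsN1·fsD + ε(Δ + ε)·fsN > 0` and `γ₀ + 8γ₁·s_node = 0` — the energy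
# dependence of the Cu-4s admixture LOWERS the one-band scale at every Fermi point beyond the node, strictly in the slope `a′`, and never at the node

Venture CertifiedManyBodySolver, cell `pub/hubbard-downfold` (stage S1; INFLATION-RULES-3to1-B §B.77), seat hubbard-downfold-mod-4 (technique B, g31);
namespace `Summit.Ventures.CertifiedManyBodySolver.Downfold.Emery`. Sequel of `EmerySecularFormDefectAxial` (§B.66: the four-orbital secular function
`sec4 = (ε_s − ε)charCubic + T·axialLin`, its derivative `dsec4`, the FIXED-FERMI-SURFACE reduction `dsec4 = (ε_s − ε)·W4 a′` with the frozen σ couplings and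
the ONE new coordinate `a′ = t_sp²/(ε_s − ε_F)²`, the node invisibility `axialLin_node_eq_zero`, the affine law `axialLin = axA + axB·(x + y)` and the
LINEAR form-defect law `formDefect4_linear` — whose monotonicity `formDefect4_mono` took `0 ≤ axialLin(antinode)` as a HYPOTHESIS), of
`EmeryFermiScaleHarmonic` (§B.75: `fsT·∂_ε charCubic = α + 8β·s` on the contour) and `EmeryFermiOneBandRange` (§B.76: the range law, model-free lemmas).
Everything PROVED (0 sorry; `ring`/`field_simp` identities + sign bookkeeping). WHAT THIS IS NOT: a statement about any material; `U = 0` one-body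
kinematics of the four-orbital model of [AndersenEtAl1995] / [PavariniEtAl2001] with the direct O–O hoppings of [HybertsenSchluterChristensen1989];
the admixture slope `a′ ≥ 0` is a model input (`a′ = 0` is the σ model).

* §1 EXACT TAYLOR IDENTITIES (`axialLin_taylor`, `sec4_taylor`: `dsec4` IS the energy derivative, no analysis) and the NEWTON STEP of the four-orbital secular
  equation in the fixed-Fermi-surface split of `EmerySecularFormDefectAxial` (`linBand4_eq`): `−sec4/dsec4 = [(ε_s − ε)fsT/dsec4]·(fsQ − cA)/fsT` — the LOCAL
  four-orbital scale times the unit `t–t′` form of the frozen σ set; on the contour that scale is `scaleT4 a′ = fsT/W4 a′` (`scale4_on_contour`).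
* §2 THE AXIAL IDENTITY (every `x, y, ε`; `ring`): **`fsT·axialLin − (2fsN1 − ε(Δ + ε))·charCubic = γ₀ + 8γ₁·(x + y − 2xy)`** (`fsT_mul_axialLin_sub`),
  `γ₀ = −(2fsN1 − ε(Δ + ε))·cA`, **`γ₁ = fsN1·fsD + ε(Δ + ε)·fsN > 0`** in the cuprate regime (`axialGamma1_eq`, `axialGamma1_pos`); at the node `axialLin = 0`
  (`axialLin_xNode`, via `axialLin_diag` of `EmeryBilayerMirror`) hence `γ₀ + 8γ₁·s_node = 0` (`axialGamma_node`).
* §3 THE HARMONIC LAW OF THE FOUR-ORBITAL SCALE: **`fsT·W4 a′ = α₄ + 8β₄·s`** on the contour (`fsT_mul_W4`), `α₄ = α + a′γ₀`, `β₄ = β + a′γ₁` (`alpha4`, `beta4`),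
  so `t⁽⁴⁾_eff(k) = scaleT4 a′ = fsT²/(α₄ + 8β₄·s(k))` (`scaleT4_eq_harmonic`; `scaleT4_zero`: `a′ = 0` is the σ scale): `1/t⁽⁴⁾` is again AFFINE in the harmonic
  — every statement of §B.75 (ordering along the surface by the sign of `β₄`: `scaleT4_anti_tpHarm`, `scaleT4_mono_tpHarm`) and the RANGE LAW of §B.76 (model-free
  lemmas `range1_misfit_lower_bound`, `range2_misfit_le`, `misfitBound_*`) hold verbatim with `(α₄, β₄)`; `β₄ − β = a′γ₁ > 0` for `a′ > 0` (`beta4_gt`).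
* §4 THE SIGN THEOREM AND THE NODE: on the contour `8fsN·(s − s_node) = 4fsT·((x + y) − 2xNode)` (`harm_sub_node_eq`), so **`axialLin > 0` at every contour
  point with `x + y > 2xNode`** (`axialLin_pos_of_node_lt`; `< 0` before the node, `axialLin_neg_of_lt_node`) — this DISCHARGES the hypothesis `0 ≤ axialLin(an)`
  of `formDefect4_mono`; `W4 a′ = ∂_ε charCubic` at the node (`W4_node`, `scaleT4_node_eq`: **the node is blind to the slope**); BEYOND THE NODE
  **`t⁽⁴⁾(a′; k) < t_σ(k)`** for `a′ > 0` (`scaleT4_lt_scaleT`) and `a′ ↦ t⁽⁴⁾(a′; k)` is STRICTLY DECREASING (`scaleT4_strictAnti_slope`) — the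
  extended-saddle-point sign of [PavariniEtAl2001] as a theorem: the Cu-4s channel's energy dependence can only LOWER the antinodal-side one-band scale;
  before the node (electron-like side) the sign reverses (`scaleT_lt_scaleT4`).
* §5 THE NODE IS BLIND TO THE CO-SHIFT TOO: `xNode`, `fsN1`, the bare nodal velocity `nodalVel2` and the nodal Cu weight `dWeightNode` are invariant under
  `(t_pp, t_pp′) ↦ (t_pp + a, t_pp′ + a)` (`xNode_coshift`, `fsN1_coshift`, `nodalVel2_coshift`, `dWeightNode_coshift`): they depend on `(Δ, t_pd, t_pp − t_pp′, ε_F)`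
  only — the materials axis of [PavariniEtAl2001] (axial admixture `a` AND its slope `a′`) cannot move them at fixed Fermi energy.

Numbers (seat-side floats, HOME/hubbard-downfold-mod-4/range-g31/explore/ex3.py, ex4.py; the law reproduces the numerically differentiated four-orbital band
velocity to 5 digits): HgBa₂CuO₄ (K) σ row co-shifted by `a = 0.40` at `x = 0.16`: `β/α = +0.032`, axial term `a′γ₁/α = +0.004…+0.025` for
`ε_s − ε_F = 16…2.5 eV`; antinodal `t` `0.560 → 0.553…0.517 eV`, nodal `0.626` unchanged; anisotropy `u − 1` `0.119 → 0.13…0.21`.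

Sources: four-orbital model [AndersenEtAl1995, Eq. (1), §§6–7]; axial orbital, range parameter, extended saddle points [PavariniEtAl2001, Eqs. (1)–(3)];
three-band model [HybertsenSchluterChristensen1989, Eq. (1)]; [folklore] algebra.
-/

noncomputable section

namespace Summit.Ventures.CertifiedManyBodySolver.Downfold.Emery

open Real Set

/-! ## §1 Exact Taylor identities and the Newton step of the four-orbital secular equation -/

/-- EXACT TAYLOR IDENTITY: `axialLin(ε + h) = axialLin(ε) + h·daxialLin + 4h²(x + y)`. [folklore] -/
theorem axialLin_taylor (Δ tpd tpp c x y ε h : ℝ) :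
    axialLin Δ tpd tpp c x y (ε + h) = axialLin Δ tpd tpp c x y ε + h * daxialLin Δ tpp c x y ε + 4 * h ^ 2 * (x + y) := by
  unfold axialLin daxialLin; ring

/-- EXACT TAYLOR IDENTITY of the quartic: `sec4(ε + h) = sec4 + h·dsec4 + h²·[(ε_s − ε)(3ε + 2Δ + 4t_pp′(x + y)) − ∂_ε charCubic + 4T(x + y)]
+ h³·[(ε_s − ε) − (3ε + 2Δ + 4t_pp′(x + y))] − h⁴` — `dsec4` IS the derivative, no analysis needed. [folklore] -/
theorem sec4_taylor (Δ εs tpd tpp c T x y ε h : ℝ) :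
    sec4 Δ εs tpd tpp c T x y (ε + h) = sec4 Δ εs tpd tpp c T x y ε + h * dsec4 Δ εs tpd tpp c T x y ε
      + h ^ 2 * ((εs - ε) * (3 * ε + 2 * Δ + 4 * c * (x + y)) - dcharCubic Δ tpd tpp c x y ε + 4 * T * (x + y))
      + h ^ 3 * ((εs - ε) - (3 * ε + 2 * Δ + 4 * c * (x + y))) - h ^ 4 := by
  unfold sec4 dsec4
  rw [charCubic_taylor, axialLin_taylor]
  ring

/-- THE NEWTON STEP in the fixed-Fermi-surface split (frozen couplings `(t_pp, t_pp′)`, direct part `(t_pp − α, t_pp′ − α)`, `T = α(ε_s − ε)`):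
`−sec4/dsec4 = [(ε_s − ε)·fsT/dsec4]·(fsQ − cA)/fsT` — the local four-orbital scale times the unit `t–t′` form of the frozen σ set (`dsec4 ≠ 0`, `fsT ≠ 0`).
[cite: AndersenEtAl1995, §6 (energy linearisation)] -/
theorem linBand4_eq {Δ εs tpd tpp c α T x y ε : ℝ} (hT : T = α * (εs - ε)) (hW : dsec4 Δ εs tpd (tpp - α) (c - α) T x y ε ≠ 0)
    (hTf : fsT Δ tpd tpp c ε ≠ 0) :
    -sec4 Δ εs tpd (tpp - α) (c - α) T x y ε / dsec4 Δ εs tpd (tpp - α) (c - α) T x y ε =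
      ((εs - ε) * fsT Δ tpd tpp c ε / dsec4 Δ εs tpd (tpp - α) (c - α) T x y ε) * ((fsQ Δ tpd tpp c x y ε - cA Δ ε) / fsT Δ tpd tpp c ε) := by
  rw [sec4_fixedFS Δ εs tpd tpp c α T x y ε hT, charCubic_eq_cA_sub_fsQ]
  field_simp
  ring

/-- The velocity-matched nearest-neighbour hopping of the four-orbital band relative to the frozen σ set's unit `t–t′` form, as a function of the admixture SLOPE
`a′`: `scaleT4 a′ = fsT/W4 a′` (`W4 a′ = ∂_ε charCubic + a′·axialLin`). [folklore] -/
def scaleT4 (Δ tpd tpp c a' x y ε : ℝ) : ℝ := fsT Δ tpd tpp c ε / W4 Δ tpd tpp c a' x y ε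

/-- ON THE CONTOUR the four-orbital scale `(ε_s − ε)·fsT/dsec4` IS `scaleT4 (α/(ε_s − ε))` (`ε ≠ ε_s`, `T = α(ε_s − ε)`). [folklore] -/
theorem scale4_on_contour {Δ εs tpd tpp c α T x y ε : ℝ} (hε : εs - ε ≠ 0) (hT : T = α * (εs - ε)) (hP : charCubic Δ tpd tpp c x y ε = 0) :
    (εs - ε) * fsT Δ tpd tpp c ε / dsec4 Δ εs tpd (tpp - α) (c - α) T x y ε = scaleT4 Δ tpd tpp c (α / (εs - ε)) x y ε := by
  unfold scaleT4
  rw [dsec4_eq_W4 Δ εs tpd tpp c α T x y ε hε hT hP, mul_div_mul_left _ _ hε]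

/-- `a′ = 0` is the σ model: `scaleT4 0 = scaleT`. [folklore] -/
theorem scaleT4_zero (Δ tpd tpp c x y ε : ℝ) : scaleT4 Δ tpd tpp c 0 x y ε = scaleT Δ tpd tpp c x y ε := by
  unfold scaleT4 scaleT W4; rw [zero_mul, add_zero]

/-! ## §2 The axial identity: `fsT·axialLin` is affine in the harmonic on the contour, positive slope, zero at the node -/

/-- `γ₀ = −(2fsN1 − ε(Δ + ε))·cA`. [folklore] -/
def axialGamma0 (Δ tpd tpp c ε : ℝ) : ℝ := -(2 * fsN1 tpd tpp c ε - ε * (Δ + ε)) * cA Δ ε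

/-- `γ₁ = fsT·fsN1 − (2fsN1 − ε(Δ + ε))·fsN`. [folklore] -/
def axialGamma1 (Δ tpd tpp c ε : ℝ) : ℝ := fsT Δ tpd tpp c ε * fsN1 tpd tpp c ε - (2 * fsN1 tpd tpp c ε - ε * (Δ + ε)) * fsN tpd tpp c ε

/-- **THE AXIAL IDENTITY** (every `x, y, ε`; no division): `fsT·axialLin − (2fsN1 − ε(Δ + ε))·charCubic = γ₀ + 8γ₁·(x + y − 2xy)`. [folklore] -/
theorem fsT_mul_axialLin_sub (Δ tpd tpp c x y ε : ℝ) :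
    fsT Δ tpd tpp c ε * axialLin Δ tpd tpp c x y ε - (2 * fsN1 tpd tpp c ε - ε * (Δ + ε)) * charCubic Δ tpd tpp c x y ε =
      axialGamma0 Δ tpd tpp c ε + 8 * axialGamma1 Δ tpd tpp c ε * tpHarm x y := by
  unfold axialGamma0 axialGamma1 tpHarm axialLin charCubic fsT fsD fsN fsN1 cA
  ring

/-- Closed form of the slope: `γ₁ = fsN1·fsD + ε(Δ + ε)·fsN`. [folklore] -/
theorem axialGamma1_eq (Δ tpd tpp c ε : ℝ) :
    axialGamma1 Δ tpd tpp c ε = fsN1 tpd tpp c ε * fsD Δ tpd c ε + ε * (Δ + ε) * fsN tpd tpp c ε := by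
  unfold axialGamma1 fsT; ring

/-- **`γ₁ > 0`** in the cuprate regime (`Δ + ε > 0`, `ε ≥ 0`, `0 ≤ t_pp′ ≤ t_pp`, `t_pd ≠ 0`, `t_pp′ε < t_pd²`). [folklore] -/
theorem axialGamma1_pos {Δ tpd tpp c ε : ℝ} (hE : 0 < Δ + ε) (hε : 0 ≤ ε) (hc : 0 ≤ c) (hct : c ≤ tpp) (htpd : tpd ≠ 0) (hm : c * ε < tpd ^ 2) :
    0 < axialGamma1 Δ tpd tpp c ε := by
  rw [axialGamma1_eq]
  have hN1 : 0 < fsN1 tpd tpp c ε := fsN1_pos hct hε htpd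
  have hD : 0 < fsD Δ tpd c ε := fsD_pos hE hm
  have hN : 0 ≤ fsN tpd tpp c ε := fsN_nonneg hc hct hε
  have h1 : 0 < fsN1 tpd tpp c ε * fsD Δ tpd c ε := mul_pos hN1 hD
  have h2 : 0 ≤ ε * (Δ + ε) * fsN tpd tpp c ε := mul_nonneg (mul_nonneg hε hE.le) hN
  linarith

/-- **THE AXIAL FORM VANISHES AT THE NODE** (`fsN1 ≠ 0`): `axialLin(xNode, xNode) = 0` — the Cu-4s channel is mirror-even, the nodal state mirror-odd
(`axialLin_diag`: `axialLin(x, x) = 8x·dQuad`). [cite: PavariniEtAl2001, text after Eq. (3) («Cu s-character proportional to v², vanishing along the nodal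
direction»)] -/
theorem axialLin_xNode {Δ tpd tpp c ε : ℝ} (hN1 : fsN1 tpd tpp c ε ≠ 0) :
    axialLin Δ tpd tpp c (xNode Δ tpd tpp c ε) (xNode Δ tpd tpp c ε) ε = 0 := by
  rw [axialLin_diag, dQuad_eq_fsD1_sub, xNode]
  field_simp
  ring

/-- On the contour, `γ₀ + 8γ₁·s_node = 0`: the axial term vanishes at the nodal harmonic (`fsN1 ≠ 0`). [folklore] -/
theorem axialGamma_node {Δ tpd tpp c ε : ℝ} (hN1 : fsN1 tpd tpp c ε ≠ 0) :
    axialGamma0 Δ tpd tpp c ε + 8 * axialGamma1 Δ tpd tpp c ε * tpHarm (xNode Δ tpd tpp c ε) (xNode Δ tpd tpp c ε) = 0 := by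
  have h := fsT_mul_axialLin_sub Δ tpd tpp c (xNode Δ tpd tpp c ε) (xNode Δ tpd tpp c ε) ε
  rw [axialLin_xNode hN1, charCubic_xNode (Δ := Δ) hN1, mul_zero, mul_zero, sub_zero] at h
  exact h.symm

/-! ## §3 The harmonic law of the four-orbital scale -/

/-- `α₄ = α + a′·γ₀`. [folklore] -/
def alpha4 (Δ tpd tpp c a' ε : ℝ) : ℝ := scaleAlpha Δ tpd tpp c ε + a' * axialGamma0 Δ tpd tpp c ε

/-- `β₄ = β + a′·γ₁`. [folklore] -/
def beta4 (Δ tpd tpp c a' ε : ℝ) : ℝ := scaleBeta Δ tpd tpp c ε + a' * axialGamma1 Δ tpd tpp c ε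

/-- **MASTER IDENTITY ON THE CONTOUR**: `fsT·W4 a′ = α₄ + 8β₄·s(k)`. [folklore] -/
theorem fsT_mul_W4 {Δ tpd tpp c x y ε : ℝ} (a' : ℝ) (hP : charCubic Δ tpd tpp c x y ε = 0) :
    fsT Δ tpd tpp c ε * W4 Δ tpd tpp c a' x y ε = alpha4 Δ tpd tpp c a' ε + 8 * beta4 Δ tpd tpp c a' ε * tpHarm x y := by
  have h1 := fsT_mul_dcharCubic_of_contour hP
  have h2 := fsT_mul_axialLin_sub Δ tpd tpp c x y ε
  rw [hP, mul_zero, sub_zero] at h2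
  unfold W4 alpha4 beta4
  linear_combination h1 + a' * h2

/-- **THE HARMONIC LAW OF THE FOUR-ORBITAL SCALE**: on the contour `t⁽⁴⁾_eff(k) = scaleT4 a′ = fsT²/(α₄ + 8β₄·s(k))` (`fsT ≠ 0`). [folklore] -/
theorem scaleT4_eq_harmonic {Δ tpd tpp c x y ε : ℝ} (a' : ℝ) (hP : charCubic Δ tpd tpp c x y ε = 0) (hT : fsT Δ tpd tpp c ε ≠ 0) :
    scaleT4 Δ tpd tpp c a' x y ε = fsT Δ tpd tpp c ε ^ 2 / (alpha4 Δ tpd tpp c a' ε + 8 * beta4 Δ tpd tpp c a' ε * tpHarm x y) := by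
  have h := fsT_mul_W4 a' hP
  have hd : W4 Δ tpd tpp c a' x y ε = (alpha4 Δ tpd tpp c a' ε + 8 * beta4 Δ tpd tpp c a' ε * tpHarm x y) / fsT Δ tpd tpp c ε := by
    rw [eq_div_iff hT]; linarith [h]
  unfold scaleT4
  rw [hd, div_div_eq_mul_div, sq]

/-- `β₄ − β = a′·γ₁ > 0` for `a′ > 0`, `γ₁ > 0`: the axial energy dependence adds a POSITIVE slope to the harmonic law. [folklore] -/
theorem beta4_gt {Δ tpd tpp c a' ε : ℝ} (ha : 0 < a') (hγ : 0 < axialGamma1 Δ tpd tpp c ε) :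
    scaleBeta Δ tpd tpp c ε < beta4 Δ tpd tpp c a' ε := by
  unfold beta4; nlinarith [mul_pos ha hγ]

/-- `β₄ ≥ 0` ⇒ `t⁽⁴⁾` NON-INCREASING in the harmonic along the contour (positive denominator at `k₁`, `fsT > 0`). [folklore] -/
theorem scaleT4_anti_tpHarm {Δ tpd tpp c a' x₁ y₁ x₂ y₂ ε : ℝ} (hP₁ : charCubic Δ tpd tpp c x₁ y₁ ε = 0) (hP₂ : charCubic Δ tpd tpp c x₂ y₂ ε = 0)
    (hT : 0 < fsT Δ tpd tpp c ε) (hW₁ : 0 < W4 Δ tpd tpp c a' x₁ y₁ ε) (hβ : 0 ≤ beta4 Δ tpd tpp c a' ε) (hs : tpHarm x₁ y₁ ≤ tpHarm x₂ y₂) :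
    scaleT4 Δ tpd tpp c a' x₂ y₂ ε ≤ scaleT4 Δ tpd tpp c a' x₁ y₁ ε := by
  have h1 := fsT_mul_W4 a' hP₁
  have hd1 : 0 < alpha4 Δ tpd tpp c a' ε + 8 * beta4 Δ tpd tpp c a' ε * tpHarm x₁ y₁ := by rw [← h1]; exact mul_pos hT hW₁
  have hd2 : alpha4 Δ tpd tpp c a' ε + 8 * beta4 Δ tpd tpp c a' ε * tpHarm x₁ y₁ ≤ alpha4 Δ tpd tpp c a' ε + 8 * beta4 Δ tpd tpp c a' ε * tpHarm x₂ y₂ := by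
    nlinarith [mul_le_mul_of_nonneg_left hs hβ]
  rw [scaleT4_eq_harmonic a' hP₁ hT.ne', scaleT4_eq_harmonic a' hP₂ hT.ne']
  exact div_le_div_of_nonneg_left (by positivity) hd1 hd2

/-- `β₄ ≤ 0` ⇒ `t⁽⁴⁾` NON-DECREASING in the harmonic along the contour (positive denominator at `k₂`, `fsT > 0`). [folklore] -/
theorem scaleT4_mono_tpHarm {Δ tpd tpp c a' x₁ y₁ x₂ y₂ ε : ℝ} (hP₁ : charCubic Δ tpd tpp c x₁ y₁ ε = 0) (hP₂ : charCubic Δ tpd tpp c x₂ y₂ ε = 0)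
    (hT : 0 < fsT Δ tpd tpp c ε) (hW₂ : 0 < W4 Δ tpd tpp c a' x₂ y₂ ε) (hβ : beta4 Δ tpd tpp c a' ε ≤ 0) (hs : tpHarm x₁ y₁ ≤ tpHarm x₂ y₂) :
    scaleT4 Δ tpd tpp c a' x₁ y₁ ε ≤ scaleT4 Δ tpd tpp c a' x₂ y₂ ε := by
  have h2 := fsT_mul_W4 a' hP₂
  have hd2 : 0 < alpha4 Δ tpd tpp c a' ε + 8 * beta4 Δ tpd tpp c a' ε * tpHarm x₂ y₂ := by rw [← h2]; exact mul_pos hT hW₂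
  have hd1 : alpha4 Δ tpd tpp c a' ε + 8 * beta4 Δ tpd tpp c a' ε * tpHarm x₂ y₂ ≤ alpha4 Δ tpd tpp c a' ε + 8 * beta4 Δ tpd tpp c a' ε * tpHarm x₁ y₁ := by
    nlinarith [mul_le_mul_of_nonpos_left hs hβ]
  rw [scaleT4_eq_harmonic a' hP₁ hT.ne', scaleT4_eq_harmonic a' hP₂ hT.ne']
  exact div_le_div_of_nonneg_left (by positivity) hd2 hd1

/-! ## §4 The sign theorem; the node is blind to the slope; beyond the node the axial channel lowers the scale -/

/-- On a contour the harmonic is affine increasing in `x + y`: `8fsN·(s(k) − s_node) = 4fsT·((x + y) − 2xNode)` (`fsN1 ≠ 0`). [folklore] -/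
theorem harm_sub_node_eq {Δ tpd tpp c x y ε : ℝ} (hN1 : fsN1 tpd tpp c ε ≠ 0) (hP : charCubic Δ tpd tpp c x y ε = 0) :
    8 * fsN tpd tpp c ε * (tpHarm x y - tpHarm (xNode Δ tpd tpp c ε) (xNode Δ tpd tpp c ε)) =
      4 * fsT Δ tpd tpp c ε * ((x + y) - 2 * xNode Δ tpd tpp c ε) := by
  have h1 := cA_add_harm Δ tpd tpp c x y ε
  have h2 := cA_add_harm Δ tpd tpp c (xNode Δ tpd tpp c ε) (xNode Δ tpd tpp c ε) ε
  rw [hP, zero_add] at h1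
  rw [charCubic_xNode (Δ := Δ) hN1, zero_add] at h2
  linear_combination h1 - h2

/-- Beyond the node the harmonic exceeds the nodal harmonic (`fsT, fsN > 0`). [folklore] -/
theorem harm_node_lt_of_node_lt {Δ tpd tpp c x y ε : ℝ} (hN1 : fsN1 tpd tpp c ε ≠ 0) (hP : charCubic Δ tpd tpp c x y ε = 0)
    (hT : 0 < fsT Δ tpd tpp c ε) (hN : 0 < fsN tpd tpp c ε) (hs : 2 * xNode Δ tpd tpp c ε < x + y) :
    tpHarm (xNode Δ tpd tpp c ε) (xNode Δ tpd tpp c ε) < tpHarm x y := by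
  have h := harm_sub_node_eq hN1 hP
  have hpos : 0 < 4 * fsT Δ tpd tpp c ε * ((x + y) - 2 * xNode Δ tpd tpp c ε) := mul_pos (by linarith) (by linarith)
  rw [← h] at hpos
  have := (mul_pos_iff_of_pos_left (by linarith : (0:ℝ) < 8 * fsN tpd tpp c ε)).1 hpos
  linarith

/-- Before the node the harmonic is below the nodal harmonic (`fsT, fsN > 0`). [folklore] -/
theorem harm_lt_node_of_lt_node {Δ tpd tpp c x y ε : ℝ} (hN1 : fsN1 tpd tpp c ε ≠ 0) (hP : charCubic Δ tpd tpp c x y ε = 0)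
    (hT : 0 < fsT Δ tpd tpp c ε) (hN : 0 < fsN tpd tpp c ε) (hs : x + y < 2 * xNode Δ tpd tpp c ε) :
    tpHarm x y < tpHarm (xNode Δ tpd tpp c ε) (xNode Δ tpd tpp c ε) := by
  have h := harm_sub_node_eq hN1 hP
  have hneg : 4 * fsT Δ tpd tpp c ε * ((x + y) - 2 * xNode Δ tpd tpp c ε) < 0 := mul_neg_of_pos_of_neg (by linarith) (by linarith)
  rw [← h] at hneg
  nlinarith

/-- **THE SIGN THEOREM**: at every contour point BEYOND THE NODE (`x + y > 2xNode`; every non-nodal point of a hole-like Fermi surface) **`axialLin > 0`**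
(`fsT, fsN > 0`, `fsN1 ≠ 0`, `γ₁ > 0`) — the hypothesis `0 ≤ axialLin(antinode)` of `formDefect4_mono` is a theorem of the regime. [folklore] -/
theorem axialLin_pos_of_node_lt {Δ tpd tpp c x y ε : ℝ} (hP : charCubic Δ tpd tpp c x y ε = 0) (hT : 0 < fsT Δ tpd tpp c ε) (hN : 0 < fsN tpd tpp c ε)
    (hN1 : fsN1 tpd tpp c ε ≠ 0) (hγ : 0 < axialGamma1 Δ tpd tpp c ε) (hs : 2 * xNode Δ tpd tpp c ε < x + y) :
    0 < axialLin Δ tpd tpp c x y ε := by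
  have hharm := harm_node_lt_of_node_lt hN1 hP hT hN hs
  have h2 := fsT_mul_axialLin_sub Δ tpd tpp c x y ε
  rw [hP, mul_zero, sub_zero] at h2
  have hnode := axialGamma_node (Δ := Δ) hN1
  have hpos : 0 < axialGamma0 Δ tpd tpp c ε + 8 * axialGamma1 Δ tpd tpp c ε * tpHarm x y := by nlinarith [mul_pos hγ (sub_pos.2 hharm)]
  rw [← h2] at hpos
  exact (mul_pos_iff_of_pos_left hT).1 hpos

/-- Before the node (`x + y < 2xNode`, electron-like side) `axialLin < 0`. [folklore] -/
theorem axialLin_neg_of_lt_node {Δ tpd tpp c x y ε : ℝ} (hP : charCubic Δ tpd tpp c x y ε = 0) (hT : 0 < fsT Δ tpd tpp c ε) (hN : 0 < fsN tpd tpp c ε)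
    (hN1 : fsN1 tpd tpp c ε ≠ 0) (hγ : 0 < axialGamma1 Δ tpd tpp c ε) (hs : x + y < 2 * xNode Δ tpd tpp c ε) :
    axialLin Δ tpd tpp c x y ε < 0 := by
  have hharm := harm_lt_node_of_lt_node hN1 hP hT hN hs
  have h2 := fsT_mul_axialLin_sub Δ tpd tpp c x y ε
  rw [hP, mul_zero, sub_zero] at h2
  have hnode := axialGamma_node (Δ := Δ) hN1
  have hneg : axialGamma0 Δ tpd tpp c ε + 8 * axialGamma1 Δ tpd tpp c ε * tpHarm x y < 0 := by nlinarith [mul_pos hγ (sub_pos.2 hharm)]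
  rw [← h2] at hneg
  by_contra hc
  push Not at hc
  have := mul_nonneg hT.le hc
  linarith

/-- AT THE NODE `W4 a′ = ∂_ε charCubic` for every slope (`fsN1 ≠ 0`). [folklore] -/
theorem W4_node {Δ tpd tpp c ε : ℝ} (a' : ℝ) (hN1 : fsN1 tpd tpp c ε ≠ 0) :
    W4 Δ tpd tpp c a' (xNode Δ tpd tpp c ε) (xNode Δ tpd tpp c ε) ε = dcharCubic Δ tpd tpp c (xNode Δ tpd tpp c ε) (xNode Δ tpd tpp c ε) ε := by
  rw [W4, axialLin_xNode hN1, mul_zero, add_zero]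

/-- **THE NODE IS BLIND TO THE SLOPE**: `t⁽⁴⁾(a′; node) = t_σ(node)` for every `a′` (`fsN1 ≠ 0`). [folklore] -/
theorem scaleT4_node_eq {Δ tpd tpp c ε : ℝ} (a' : ℝ) (hN1 : fsN1 tpd tpp c ε ≠ 0) :
    scaleT4 Δ tpd tpp c a' (xNode Δ tpd tpp c ε) (xNode Δ tpd tpp c ε) ε = scaleT Δ tpd tpp c (xNode Δ tpd tpp c ε) (xNode Δ tpd tpp c ε) ε := by
  unfold scaleT4 scaleT; rw [W4_node a' hN1]

/-- **BEYOND THE NODE THE AXIAL CHANNEL LOWERS THE SCALE**: `a′ > 0`, `x + y > 2xNode`, positive σ energy denominator ⇒ `t⁽⁴⁾(a′; k) < t_σ(k)`.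
[cite: PavariniEtAl2001, text after Eq. (3) (extended saddle points from the Cu-s repulsion)] -/
theorem scaleT4_lt_scaleT {Δ tpd tpp c a' x y ε : ℝ} (ha : 0 < a') (hP : charCubic Δ tpd tpp c x y ε = 0) (hT : 0 < fsT Δ tpd tpp c ε)
    (hN : 0 < fsN tpd tpp c ε) (hN1 : fsN1 tpd tpp c ε ≠ 0) (hW : 0 < dcharCubic Δ tpd tpp c x y ε) (hγ : 0 < axialGamma1 Δ tpd tpp c ε)
    (hs : 2 * xNode Δ tpd tpp c ε < x + y) :
    scaleT4 Δ tpd tpp c a' x y ε < scaleT Δ tpd tpp c x y ε := by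
  have hax := axialLin_pos_of_node_lt hP hT hN hN1 hγ hs
  have hW4 : 0 < W4 Δ tpd tpp c a' x y ε := by unfold W4; positivity
  unfold scaleT4 scaleT
  rw [div_lt_div_iff₀ hW4 hW, W4]
  nlinarith [mul_pos hT (mul_pos ha hax)]

/-- **STRICTLY DECREASING IN THE SLOPE beyond the node**: `a₁ < a₂`, `W4 a₁ > 0` ⇒ `t⁽⁴⁾(a₂; k) < t⁽⁴⁾(a₁; k)` — more energy dependence of the Cu-4s channel,
SLOWER antinodal side. [folklore] -/
theorem scaleT4_strictAnti_slope {Δ tpd tpp c a₁ a₂ x y ε : ℝ} (h12 : a₁ < a₂) (hP : charCubic Δ tpd tpp c x y ε = 0) (hT : 0 < fsT Δ tpd tpp c ε)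
    (hN : 0 < fsN tpd tpp c ε) (hN1 : fsN1 tpd tpp c ε ≠ 0) (hW₁ : 0 < W4 Δ tpd tpp c a₁ x y ε) (hγ : 0 < axialGamma1 Δ tpd tpp c ε)
    (hs : 2 * xNode Δ tpd tpp c ε < x + y) :
    scaleT4 Δ tpd tpp c a₂ x y ε < scaleT4 Δ tpd tpp c a₁ x y ε := by
  have hax := axialLin_pos_of_node_lt hP hT hN hN1 hγ hs
  have hW₂ : 0 < W4 Δ tpd tpp c a₂ x y ε := by
    unfold W4 at *; nlinarith [mul_pos (sub_pos.2 h12) hax]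
  unfold scaleT4
  rw [div_lt_div_iff₀ hW₂ hW₁]
  unfold W4
  nlinarith [mul_pos hT (mul_pos (sub_pos.2 h12) hax)]

/-- BEFORE THE NODE (electron-like side, `x + y < 2xNode`) the sign reverses: `t_σ(k) < t⁽⁴⁾(a′; k)` (`a′ > 0`, `W4 a′ > 0`). [folklore] -/
theorem scaleT_lt_scaleT4 {Δ tpd tpp c a' x y ε : ℝ} (ha : 0 < a') (hP : charCubic Δ tpd tpp c x y ε = 0) (hT : 0 < fsT Δ tpd tpp c ε)
    (hN : 0 < fsN tpd tpp c ε) (hN1 : fsN1 tpd tpp c ε ≠ 0) (hW4 : 0 < W4 Δ tpd tpp c a' x y ε) (hγ : 0 < axialGamma1 Δ tpd tpp c ε)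
    (hs : x + y < 2 * xNode Δ tpd tpp c ε) :
    scaleT Δ tpd tpp c x y ε < scaleT4 Δ tpd tpp c a' x y ε := by
  have hax := axialLin_neg_of_lt_node hP hT hN hN1 hγ hs
  have hW : 0 < dcharCubic Δ tpd tpp c x y ε := by
    unfold W4 at hW4; nlinarith [mul_pos ha (neg_pos.2 hax)]
  unfold scaleT4 scaleT
  rw [div_lt_div_iff₀ hW hW4, W4]
  nlinarith [mul_pos hT (mul_pos ha (neg_pos.2 hax))]

/-! ## §5 The node is blind to the co-shift (the admixture itself), not only to its slope -/

/-- `fsN1` is co-shift invariant. [folklore] -/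
theorem fsN1_coshift (tpd tpp c a ε : ℝ) : fsN1 tpd (tpp + a) (c + a) ε = fsN1 tpd tpp c ε := by
  unfold fsN1; ring

/-- `xNode` is co-shift invariant: the nodal Fermi point depends on `(Δ, t_pd, t_pp − t_pp′, ε)` only. [folklore] -/
theorem xNode_coshift (Δ tpd tpp c a ε : ℝ) : xNode Δ tpd (tpp + a) (c + a) ε = xNode Δ tpd tpp c ε := by
  unfold xNode; rw [fsN1_coshift]

/-- **THE NODAL Cu WEIGHT IS BLIND TO THE AXIAL CHANNEL**: `w_node` is co-shift invariant (`Δ ≥ 0`, `0 ≤ t_pp′ ≤ t_pp`, `a ≥ 0`, `ε > 0`, `t_pd ≠ 0`).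
[folklore] -/
theorem dWeightNode_coshift {Δ tpd tpp c a ε : ℝ} (hΔ : 0 ≤ Δ) (hc : 0 ≤ c) (hg : c ≤ tpp) (ha : 0 ≤ a) (hε : 0 < ε) (htpd : tpd ≠ 0) :
    dWeightNode Δ tpd (tpp + a) (c + a) ε = dWeightNode Δ tpd tpp c ε := by
  rw [dWeightNode_eq hΔ (by linarith) (by linarith) hε htpd, dWeightNode_eq hΔ hc hg hε htpd]
  ring_nf

/-- **THE BARE NODAL VELOCITY IS BLIND TO THE AXIAL CHANNEL**: `nodalVel2` at the node is co-shift invariant (`fsN1 ≠ 0`, non-zero nodal energy denominators)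
— on the zone diagonal the `d`–`(pₓ − p_y)` block (hoppings `t_pd`, `t_pp − t_pp′`) decouples from the mirror-even `(pₓ + p_y)`/Cu-s block that the co-shift
moves. [cite: AndersenEtAl1995, §6, Eq. (24)] -/
theorem nodalVel2_coshift {Δ tpd tpp c a ε : ℝ} (hN1 : fsN1 tpd tpp c ε ≠ 0)
    (hW : dcharCubic Δ tpd tpp c (xNode Δ tpd tpp c ε) (xNode Δ tpd tpp c ε) ε ≠ 0)
    (hWa : dcharCubic Δ tpd (tpp + a) (c + a) (xNode Δ tpd tpp c ε) (xNode Δ tpd tpp c ε) ε ≠ 0) :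
    nodalVel2 Δ tpd (tpp + a) (c + a) (xNode Δ tpd tpp c ε) ε = nodalVel2 Δ tpd tpp c (xNode Δ tpd tpp c ε) ε := by
  unfold nodalVel2
  rw [div_eq_div_iff (pow_ne_zero 2 hWa) (pow_ne_zero 2 hW)]
  unfold xNode at *
  unfold dcharCubic dcA dfsD dfsN fsD fsN fsD1 fsN1 at *
  field_simp
  ring

/-! ## §6 (appended) ON A ZONE CONTOUR THE NODE IS THE MINIMUM OF `x + y` — FOR BOTH TOPOLOGIES (hole-like surfaces end on the face `x = 1`, electron-like
ones on the axis `y = 0`; AM–GM bound `sum_mem_Icc_xNode_yFace` of `EmeryOrbitalWeightCheck`): the «before the node» lemmas of §4 (`x + y < 2xNode`: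
`axialLin_neg_of_lt_node`, `scaleT_lt_scaleT4`, `harm_lt_node_of_lt_node`) are VACUOUS on zone Fermi surfaces and their docstring gloss «electron-like side» is
withdrawn; the physical statements are the ZONE forms below — at EVERY zone Fermi point `axialLin ≥ 0` and `t⁽⁴⁾(a′) ≤ t_σ`, with equality exactly at the node,
on hole-like AND electron-like surfaces (consistent with a non-negative Cu-4s weight `∝ a′·axialLin`) -/

/-- ON A ZONE CONTOUR the harmonic is at least the nodal harmonic (`fsN, fsD > 0`, `ε ≥ 0`, `fsN1 ≠ 0`, `0 ≤ x, y ≤ 1`). [folklore] -/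
theorem harm_node_le_on_zone {Δ tpd tpp c x y ε : ℝ} (hP : charCubic Δ tpd tpp c x y ε = 0) (hN : 0 < fsN tpd tpp c ε) (hD : 0 < fsD Δ tpd c ε)
    (hε : 0 ≤ ε) (hN1 : fsN1 tpd tpp c ε ≠ 0) (hx : x ∈ Set.Icc (0 : ℝ) 1) (hy : y ∈ Set.Icc (0 : ℝ) 1) :
    tpHarm (xNode Δ tpd tpp c ε) (xNode Δ tpd tpp c ε) ≤ tpHarm x y := by
  have hs := (sum_mem_Icc_xNode_yFace hN hD hε hN1 hx hy hP).1
  have hT : 0 < fsT Δ tpd tpp c ε := by unfold fsT; linarith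
  have h := harm_sub_node_eq hN1 hP
  have hrhs : 0 ≤ 4 * fsT Δ tpd tpp c ε * ((x + y) - 2 * xNode Δ tpd tpp c ε) := mul_nonneg (by linarith) (by linarith)
  rw [← h] at hrhs
  nlinarith

/-- **ON A ZONE CONTOUR `axialLin ≥ 0`** (regime `fsN, fsD > 0`, `ε ≥ 0`, `fsN1 ≠ 0`, `γ₁ > 0`; `0 ≤ x, y ≤ 1`) — every zone Fermi point, both topologies.
[folklore] -/
theorem axialLin_nonneg_on_zone {Δ tpd tpp c x y ε : ℝ} (hP : charCubic Δ tpd tpp c x y ε = 0) (hN : 0 < fsN tpd tpp c ε) (hD : 0 < fsD Δ tpd c ε)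
    (hε : 0 ≤ ε) (hN1 : fsN1 tpd tpp c ε ≠ 0) (hγ : 0 < axialGamma1 Δ tpd tpp c ε) (hx : x ∈ Set.Icc (0 : ℝ) 1) (hy : y ∈ Set.Icc (0 : ℝ) 1) :
    0 ≤ axialLin Δ tpd tpp c x y ε := by
  have hT : 0 < fsT Δ tpd tpp c ε := by unfold fsT; linarith
  have hharm := harm_node_le_on_zone hP hN hD hε hN1 hx hy
  have h2 := fsT_mul_axialLin_sub Δ tpd tpp c x y ε
  rw [hP, mul_zero, sub_zero] at h2
  have hnode := axialGamma_node (Δ := Δ) hN1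
  have hnn : 0 ≤ axialGamma0 Δ tpd tpp c ε + 8 * axialGamma1 Δ tpd tpp c ε * tpHarm x y := by nlinarith [mul_nonneg hγ.le (sub_nonneg.2 hharm)]
  rw [← h2] at hnn
  by_contra hc
  push Not at hc
  have := mul_neg_of_pos_of_neg hT hc
  linarith

/-- **ON A ZONE CONTOUR `t⁽⁴⁾(a′; k) ≤ t_σ(k)` AT EVERY FERMI POINT** (`a′ ≥ 0`, positive σ energy denominator; regime of `axialLin_nonneg_on_zone`) — the axial
channel never raises the one-band scale; strict beyond the node (`scaleT4_lt_scaleT`), equality at the node (`scaleT4_node_eq`). [folklore] -/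
theorem scaleT4_le_scaleT_on_zone {Δ tpd tpp c a' x y ε : ℝ} (ha : 0 ≤ a') (hP : charCubic Δ tpd tpp c x y ε = 0) (hN : 0 < fsN tpd tpp c ε)
    (hD : 0 < fsD Δ tpd c ε) (hε : 0 ≤ ε) (hN1 : fsN1 tpd tpp c ε ≠ 0) (hγ : 0 < axialGamma1 Δ tpd tpp c ε) (hW : 0 < dcharCubic Δ tpd tpp c x y ε)
    (hx : x ∈ Set.Icc (0 : ℝ) 1) (hy : y ∈ Set.Icc (0 : ℝ) 1) :
    scaleT4 Δ tpd tpp c a' x y ε ≤ scaleT Δ tpd tpp c x y ε := by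
  have hT : 0 < fsT Δ tpd tpp c ε := by unfold fsT; linarith
  have hax := axialLin_nonneg_on_zone hP hN hD hε hN1 hγ hx hy
  have hW4 : dcharCubic Δ tpd tpp c x y ε ≤ W4 Δ tpd tpp c a' x y ε := by unfold W4; nlinarith [mul_nonneg ha hax]
  unfold scaleT4 scaleT
  exact div_le_div_of_nonneg_left hT.le hW hW4

/-- ON A ZONE CONTOUR the harmonic EQUALS the nodal harmonic only at the nodal sum `x + y = 2xNode` (`fsN ≠ 0`, `fsN1 ≠ 0`): so `axialLin = 0` exactly there and
`> 0` at every other zone Fermi point (`axialLin_pos_of_node_lt`). [folklore] -/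
theorem harm_eq_node_iff {Δ tpd tpp c x y ε : ℝ} (hP : charCubic Δ tpd tpp c x y ε = 0) (hN : fsN tpd tpp c ε ≠ 0) (hT : fsT Δ tpd tpp c ε ≠ 0)
    (hN1 : fsN1 tpd tpp c ε ≠ 0) :
    tpHarm x y = tpHarm (xNode Δ tpd tpp c ε) (xNode Δ tpd tpp c ε) ↔ x + y = 2 * xNode Δ tpd tpp c ε := by
  have h := harm_sub_node_eq hN1 hP
  constructor
  · intro he
    rw [he, sub_self, mul_zero] at h
    have := (mul_eq_zero.1 h.symm).resolve_left (mul_ne_zero (by norm_num) hT)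
    linarith
  · intro he
    rw [he, sub_self, mul_zero] at h
    have := (mul_eq_zero.1 h).resolve_left (mul_ne_zero (by norm_num) hN)
    linarith

end Summit.Ventures.CertifiedManyBodySolver.Downfold.Emery
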